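import Literature.NumberTheory.Sieve.SelbergSieveOptionBox
import Literature.NumberTheory.Sieve.Maynard2016Prop94YBound
import HarnessLib

/-!
# Maynard's Proposition 9.4: reindexing the coupled quadratic form by the Option box

Source: J. Maynard, *Dense clusters of primes in subsets*, Compositio Math. 152 (2016) =
arXiv:1405.2593 [Maynard2016DenseClusters], proof of Proposition 9.4 pp. 25–26 («the `k+1`-dimensional
sieve with `L_{k+1} = L`, weights `y_{r,r₀} = y_r ỹ_{r₀}`»).

The majorant expansion (`Maynard2016Prop94Expansion`) produces the coupled quadratic form as a four-fold sum
over `d, e ∈ 𝒟_k(𝓛)` and `d₀, e₀ ∈ box₀ M R₀` with the cross-coprimality indicator of the `(k+1)`-tuple,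
while the Selberg-box evaluation (`Maynard2016Prop94QuadFormBound`) is stated over the Option-indexed box
`gBox (optN ⌊R⌋ R₀) (optW (idxMod 𝓛 B R) M)` with the product weights `lamProd = λ_d λ̃_{d₀}`. This file
identifies the two (`quadFormPlus_eq_sum4`): the bijection `(d, d₀) ↦ (o ↦ o.elim d₀ d)` between
coupling-coprime pairs and the Option box (`sum_gBox_opt_eq`), the agreement of the cross-coprimality
conditions (`crossOpt_iff`), `∏_o [d_o, e_o] = [d₀,e₀] ∏_i [d_i,e_i]` and `λ⁺ = λ_d λ̃_{d₀}`
(`lamVar_eq_lamOfY`).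

## References
* J. Maynard, *Dense clusters of primes in subsets*, Compositio Math. 152 (2016), proof of Prop. 9.4
  pp. 25–26 [Maynard2016DenseClusters].
-/

open Finset

namespace Literature.NumberTheory.Sieve.FGKMT2018

variable {k : ℕ}

/-- The glueing map `(d, d₀) ↦ d⁺` with `d⁺(some i) = d_i`, `d⁺(none) = d₀`.
[cite: Maynard2016DenseClusters, proof of Prop. 9.4 p. 25 (the (k+1)-tuples (d, d₀))] -/
theorem elim_comp_some {κ : Type*} (d : κ → ℕ) (d₀ : ℕ) :
    (fun i => (fun o : Option κ => o.elim d₀ d) (some i)) = d := rfl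

/-- **Sums over the Option box as double sums**: for any `Φ`,
`∑_{d⁺ ∈ gBox(optN N₁ R₀)(optW W₁ M)} Φ(d⁺) = ∑_{d ∈ gBox N₁ W₁} ∑_{d₀ ∈ box₀ M R₀} 1[(∏d, d₀)=1] Φ(o ↦ o.elim d₀ d)`.
[cite: Maynard2016DenseClusters, proof of Prop. 9.4 p. 25 («(d₀, d) ranging over … with (d₀ ∏ d_i, W) = 1, μ² = 1»)] -/
theorem sum_gBox_opt_eq {κ : Type*} [Fintype κ] [DecidableEq κ] (N₁ W₁ : κ → ℕ) (M : ℕ) (R₀ : ℝ)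
    (Φ : (Option κ → ℕ) → ℝ) :
    ∑ d ∈ SelbergBox.gBox (SelbergBox.optN N₁ R₀) (SelbergBox.optW W₁ M), Φ d =
      ∑ d ∈ SelbergBox.gBox N₁ W₁, ∑ d₀ ∈ SelbergBox.box₀ M R₀,
        (if (∏ i, d i).Coprime d₀ then Φ (fun o : Option κ => o.elim d₀ d) else 0) := by
  classical
  rw [← Finset.sum_product', ← Finset.sum_filter]
  symm
  refine Finset.sum_nbij' (fun p => fun o : Option κ => o.elim p.2 p.1)
    (fun d => ((fun i => d (some i)), d none)) ?_ ?_ ?_ ?_ ?_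
  · intro p hp
    rw [Finset.mem_filter, Finset.mem_product] at hp
    rw [SelbergBox.mem_gBox_opt]
    exact ⟨hp.1.1, hp.1.2, hp.2⟩
  · intro d hd
    rw [SelbergBox.mem_gBox_opt] at hd
    rw [Finset.mem_filter, Finset.mem_product]
    exact ⟨⟨hd.1, hd.2.1⟩, hd.2.2⟩
  · intro p _
    rfl
  · intro d _
    funext o
    cases o <;> rfl
  · intro p _
    rfl

/-- **The cross-coprimality condition of the glued tuples**: for `d⁺ = (d, d₀)`, `e⁺ = (e, e₀)`,
`(d⁺_o e⁺_o, d⁺_{o'} e⁺_{o'}) = 1 ∀ o ≠ o'` iff `(d_ie_i, d_je_j) = 1 ∀ i ≠ j` and `(d₀e₀, d_ie_i) = 1 ∀ i`.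
[cite: Maynard2016DenseClusters, proof of Prop. 9.4 p. 26, proof of Prop. 9.1 p. 19] -/
theorem crossOpt_iff {κ : Type*} (d e : κ → ℕ) (d₀ e₀ : ℕ) :
    (∀ o o' : Option κ, o ≠ o' →
        ((fun o : Option κ => o.elim d₀ d) o * (fun o : Option κ => o.elim e₀ e) o).Coprime
          ((fun o : Option κ => o.elim d₀ d) o' * (fun o : Option κ => o.elim e₀ e) o')) ↔
      (∀ i j, i ≠ j → (d i * e i).Coprime (d j * e j)) ∧ ∀ i, (d₀ * e₀).Coprime (d i * e i) := by
  constructor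
  · intro h
    refine ⟨fun i j hij => ?_, fun i => ?_⟩
    · simpa using h (some i) (some j) (fun h' => hij (Option.some_injective _ h'))
    · simpa using h none (some i) (Option.some_ne_none i).symm
  · rintro ⟨h, h₀⟩ o o' hoo'
    cases o with
    | none =>
      cases o' with
      | none => exact absurd rfl hoo'
      | some j => simpa using h₀ j
    | some i =>
      cases o' with
      | none => simpa using (h₀ i).symm
      | some j => simpa using h i j (fun h' => hoo' (by rw [h']))

/-- **The coupled quadratic form, reindexed**: with `G⁺ = gBox(optN ⌊R⌋ R₀)(optW (idxMod 𝓛 B R) M)`,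
`λ⁺ = lamProd` (`= λ_d λ̃_{d₀}`),
`∑_{d⁺,e⁺ ∈ G⁺, cross-coprime} λ⁺_{d⁺}λ⁺_{e⁺}/∏_o[d⁺_o,e⁺_o] = ∑_{d,e ∈ 𝒟_k} ∑_{d₀,e₀ ∈ box₀} 1[cross-coprime] λ_dλ_e λ̃_{d₀}λ̃_{e₀}/([d₀,e₀]∏_i[d_i,e_i])`.
[cite: Maynard2016DenseClusters, proof of Prop. 9.4 pp. 25–26] -/
theorem quadFormPlus_eq_sum4 (L : Fin k → ℤ × ℤ) (B : ℕ) (R : ℝ) (F : (Fin k → ℝ) → ℝ) (M : ℕ)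
    (R₀ : ℝ) :
    ∑ d ∈ SelbergBox.gBox (SelbergBox.optN (fun _ : Fin k => ⌊R⌋₊) R₀)
        (SelbergBox.optW (idxMod L B R) M),
      ∑ e ∈ SelbergBox.gBox (SelbergBox.optN (fun _ : Fin k => ⌊R⌋₊) R₀)
          (SelbergBox.optW (idxMod L B R) M),
        (if ∀ i l, i ≠ l → (d i * e i).Coprime (d l * e l) then
          SelbergBox.lamProd (fun _ : Fin k => ⌊R⌋₊) (idxMod L B R)
              (fun g => yVar L B R F g / phiOmega L (∏ i, g i)) M R₀ d *
            SelbergBox.lamProd (fun _ : Fin k => ⌊R⌋₊) (idxMod L B R)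
              (fun g => yVar L B R F g / phiOmega L (∏ i, g i)) M R₀ e /
            ∏ o, ((Nat.lcm (d o) (e o) : ℕ) : ℝ)
        else 0) =
      ∑ d ∈ dkBox L B R, ∑ e ∈ dkBox L B R,
        ∑ d₀ ∈ SelbergBox.box₀ M R₀, ∑ e₀ ∈ SelbergBox.box₀ M R₀,
          (if (∀ i j, i ≠ j → (d i * e i).Coprime (d j * e j)) ∧
              ∀ i, (d₀ * e₀).Coprime (d i * e i) then
            lamVar L B R F d * lamVar L B R F e *
                (SelbergBox.lamT M R₀ d₀ * SelbergBox.lamT M R₀ e₀) /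
              (((Nat.lcm d₀ e₀ : ℕ) : ℝ) * ∏ ι, ((Nat.lcm (d ι) (e ι) : ℕ) : ℝ))
          else 0) := by
  classical
  rw [sum_gBox_opt_eq, dkBox_eq_gBox]
  refine Finset.sum_congr rfl fun d hd => ?_
  -- push the coupling indicator inside and swap `d₀` with `e`
  have hinner : ∀ d₀ ∈ SelbergBox.box₀ M R₀,
      (if (∏ i, d i).Coprime d₀ then
        ∑ e ∈ SelbergBox.gBox (SelbergBox.optN (fun _ : Fin k => ⌊R⌋₊) R₀)
            (SelbergBox.optW (idxMod L B R) M),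
          (if ∀ i l, i ≠ l → ((fun o : Option (Fin k) => o.elim d₀ d) i * e i).Coprime
              ((fun o : Option (Fin k) => o.elim d₀ d) l * e l) then
            SelbergBox.lamProd (fun _ : Fin k => ⌊R⌋₊) (idxMod L B R)
                (fun g => yVar L B R F g / phiOmega L (∏ i, g i)) M R₀
                (fun o : Option (Fin k) => o.elim d₀ d) *
              SelbergBox.lamProd (fun _ : Fin k => ⌊R⌋₊) (idxMod L B R)
                (fun g => yVar L B R F g / phiOmega L (∏ i, g i)) M R₀ e /
              ∏ o, ((Nat.lcm ((fun o : Option (Fin k) => o.elim d₀ d) o) (e o) : ℕ) : ℝ)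
          else 0) else 0) =
        ∑ e ∈ SelbergBox.gBox (fun _ : Fin k => ⌊R⌋₊) (idxMod L B R),
          ∑ e₀ ∈ SelbergBox.box₀ M R₀,
            (if (∀ i j, i ≠ j → (d i * e i).Coprime (d j * e j)) ∧
                ∀ i, (d₀ * e₀).Coprime (d i * e i) then
              lamVar L B R F d * lamVar L B R F e *
                  (SelbergBox.lamT M R₀ d₀ * SelbergBox.lamT M R₀ e₀) /
                (((Nat.lcm d₀ e₀ : ℕ) : ℝ) * ∏ ι, ((Nat.lcm (d ι) (e ι) : ℕ) : ℝ))
            else 0) := by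
    intro d₀ hd₀
    by_cases hc : (∏ i, d i).Coprime d₀
    · rw [if_pos hc, sum_gBox_opt_eq]
      refine Finset.sum_congr rfl fun e he => Finset.sum_congr rfl fun e₀ he₀ => ?_
      by_cases hc' : (∏ i, e i).Coprime e₀
      · rw [if_pos hc']
        have hiff := crossOpt_iff d e d₀ e₀
        by_cases hx : (∀ i j, i ≠ j → (d i * e i).Coprime (d j * e j)) ∧
            ∀ i, (d₀ * e₀).Coprime (d i * e i)
        · rw [if_pos (hiff.2 hx), if_pos hx]
          unfold SelbergBox.lamProd
          rw [Fintype.prod_option, ← lamVar_eq_lamOfY, ← lamVar_eq_lamOfY]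
          simp only [Option.elim_none, Option.elim_some]
          ring
        · rw [if_neg (fun h => hx (hiff.1 h)), if_neg hx]
      · rw [if_neg hc', if_neg]
        rintro ⟨-, h₀⟩
        apply hc'
        rw [Nat.coprime_comm]
        refine Nat.Coprime.prod_right fun i _ => ?_
        exact Nat.Coprime.coprime_dvd_left (dvd_mul_left e₀ d₀)
          (Nat.Coprime.coprime_dvd_right (dvd_mul_left (e i) (d i)) (h₀ i))
    · rw [if_neg hc]
      symm
      refine Finset.sum_eq_zero fun e _ => Finset.sum_eq_zero fun e₀ _ => ?_
      rw [if_neg]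
      rintro ⟨-, h₀⟩
      apply hc
      refine Nat.Coprime.prod_left fun i _ => ?_
      exact Nat.Coprime.coprime_dvd_left (dvd_mul_right (d i) (e i))
        (Nat.Coprime.coprime_dvd_right (dvd_mul_right d₀ e₀) (h₀ i).symm)
  rw [Finset.sum_congr rfl hinner, Finset.sum_comm]

end Literature.NumberTheory.Sieve.FGKMT2018
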